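import Literature.AlgebraicGeometry.HodgeTheory.WeilClassesMoonenZarhinCriterion
import Literature.AlgebraicGeometry.HodgeTheory.GlobalInvariantCycles
import Literature.AlgebraicGeometry.Motives.FamiliesVHS
import HarnessLib.Audit
import HarnessLib

/-!
# WeilTypeLadder · R3anc — ALGEBRAICALLY ANCHORED `K`-Weil families through every Weil class (conjecture leaf)

b2b cell `hweil` (packet `run/shared/lean/b2b/hodge-weil/`; analysis `b2b-hweil-pv2/COR-11-2-4.md` §3–§5),
prover 2 (variational). ONE `@[conjecture]` definition, an obligation of `HodgeConjecture/HodgeConjecture`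
(a CASE of the summit — under HC the constant family `A ⟶ Spec ℂ` anchored at `A` itself is a witness:
on-path lemma `anchoredWeilFamiliesCMField_of_hodgeConjecture` in the sibling
`Theorems/WeilTypeLadderAnchorsOnPath.lean`), completing the variational decomposition of the CM rung:

  R3 `WeilClassesCMField`  ⟸  R3anc `AnchoredWeilFamiliesCMField` ∧ R3var `WeilVariationalHodgeCMField`
  (glue `weilClassesCMField_of_anchored_of_variational`, kernel-checked in the OnPath sibling), and
  R3var ⟸ LOCAL-R3var (`weilVariationalHodgeCMField_of_local`, `Theorems/WeilTypeLadderVariationalLocal.lean`).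

WHAT IT TYPES — the "anchor supply" half of Markman's strategy for a CM field `K` (arXiv:2509.23079,
UNREFEREED): §1.1 / Thm. 1.1.2 / Cor. 11.2.4 (chunk 33: "Assume that the class `c` is algebraic. If the flat
deformation of the algebraic class `κ_{d/2}(φ̌(c))` […] remains algebraic in `H^d(A, ℚ)`, then every class
in `HW(A, η′)` is algebraic") together with Lemma 10.2.3 (chunk 29: "Assume that `(X × X̂, η, Ξ_t)` is of
split Weil type. Every `2n`-dimensional polarized abelian variety of split Weil type `(A′, η′, h)` […] is
isomorphic to `((A, I), η, Ξ_{t′})`, for some `I ∈ Ω_{B,t′}`") say: every (split) `K`-Weil abelian variety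
lies on a `K`-Weil family through a product point `X × X̂` carrying an ALGEBRAIC class (`κ_{d/2}` of the
Orlov image of `B`-secant sheaves) whose flat transport stays Hodge and has non-zero Weil component
(Prop. 11.2.2). Deligne's family (LNM 900, Thm. 4.8 (a)–(c); Charles–Schnell Thm. 11.5.24) has the same
shape with anchor `A₀ ⊗_ℚ K`, where the Weil classes are only known ABSOLUTE HODGE ((4.5) and Milne's
endnote M.11 with footnote 7) — hence Markman's product anchors. On the tree's carriers (those of R3 /
R3var: `weilClassesField`, `IsSmoothProjectiveFamily`, `fiberι`, global class `W`, charts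
`e′ : A′.X ≅ 𝒳_s`, engine-ready base hypotheses), with the secant machinery (`Φ`, `B`, `κ`, `Ω_B`)
abstracted to "a family and a global Weil-confined class, algebraic at one fibre, passing through the
given class":

* `AnchoredWeilFamiliesCMField` (R3anc): for every `(A, φ, P, e, m)` as in R3 (`K = ℚ(φ) ≅ ℚ[T]/(P)` a CM
  field of degree `e > 2`, `e·2m = 2 dim A`) and every rational `(m,m)`-class `c ≠ 0` of
  `weilClassesField A φ P (2m)`, there exist a smooth projective family `f : 𝒳 ⟶ S` of relative
  dimension `e·m` with `𝒳`, `S` quasi-projective, `S` smooth irreducible, complex points `s₁, s₀`, an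
  isomorphism `ι : A.X ≅ 𝒳_{s₁}`, and a global class `W ∈ H^{2m}(𝒳(ℂ); ℂ)`, fibrewise rational of type
  `(m,m)` and Weil-confined through charts (as in R3var), with `ι^*(W|_{𝒳_{s₁}}) = c` and `W|_{𝒳_{s₀}}`
  ALGEBRAIC.

Confinement to the Weil space loses nothing against print: `κ_{d/2} = δ + γ` with `δ ∈ Sym^{d/2}(𝔄²)`,
`𝔄²` = classes staying `(1,1)` on the whole component (algebraic everywhere by Lefschetz `(1,1)`, tree
theorem `lefschetzOneOne_rational_holds`, and products of divisor classes), so the flat Weil component `γ`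
is itself algebraic at the anchor and is the class to transport. SPLIT type is not a hypothesis (DIVERGENCE
D4: `IsHyperbolicWeilType` is typed for `φ² = -d` only); as a conjecture R3anc is thus formally MORE
demanding than Markman's programme (which supplies anchors on split components and leaves the rest to
descent), never asserting anything. OPEN; for `e = 2`, `n ≤ 3` split components it is Markman's
construction (arXiv:2502.03415 §9, Thm. 1.5.1); for `[K:ℚ] = 4` at genus-4 Jacobians the secant sheaves of
companion §12 / Lemma 12.2.1 give the anchor CLASS, the component-covering being Lemma 10.2.3.
[status: open]
-/

-- every declaration of this problem lives in `Summit.HodgeConjecture.HodgeConjecture.…` (summit = sub-problem)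
set_option linter.dupNamespace false

noncomputable section

open CategoryTheory

namespace Summit.HodgeConjecture.HodgeConjecture.WeilTypeLadder

open Literature.AlgebraicGeometry Literature.AlgebraicGeometry.Motives
open Literature.AlgebraicGeometry.HodgeTheory
open Literature.AlgebraicTopology.SingularHomology

/-- **R3anc — every non-zero Weil class of a CM field `K = ℚ(φ) ≅ ℚ[T]/(P)` (`[K:ℚ] = e > 2`) sits on a
smooth projective `K`-Weil family with an ALGEBRAIC anchor** (the anchor-supply half of Markman's CM
strategy, arXiv:2509.23079 Thm. 1.1.2 / Cor. 11.2.4 with Lemma 10.2.3, secant machinery abstracted; same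
carriers and CM rendering as `WeilClassesCMField` / `WeilVariationalHodgeCMField`). Data as in R3 plus a
class `c ≠ 0`; conclusion: `∃` family `f : 𝒳 ⟶ S` (relative dimension `e·m`; `𝒳`, `S` quasi-projective;
`S` smooth irreducible), `s₁ s₀ : S(ℂ)`, `ι : A.X ≅ 𝒳_{s₁}`, `W ∈ H^{2m}(𝒳(ℂ); ℂ)` fibrewise rational of
type `(m,m)` and carried by charts into `weilClassesField`, with `ι^*(W|_{𝒳_{s₁}}) = c` and `W|_{𝒳_{s₀}}`
algebraic. With R3var it gives R3 (`weilClassesCMField_of_anchored_of_variational`). OPEN. A CASE of the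
summit (`anchoredWeilFamiliesCMField_of_hodgeConjecture`: under HC the constant family anchored at `A`).
[cite: Markman2025SecantRealMultiplication, Thm. 1.1.2, Cor. 11.2.4 and Lemma 10.2.3]
[cite: Deligne1982HodgeCycles, Thm. 4.8 (proof, (a)–(c), p. 32)] [status: open] -/
@[conjecture] def AnchoredWeilFamiliesCMField : Prop :=
  ∀ (A : Motives.AbelianVariety ℂ) (φ : A ⟶ A) (P : Polynomial ℤ) (e m : ℕ),
    P.Monic → P.natDegree = e → 2 < e → Irreducible (P.map (Int.castRingHom ℚ)) →
    Polynomial.eval₂ (Int.castRingHom (CategoryTheory.End A)) (φ : CategoryTheory.End A) P = 0 →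
    e * (2 * m) = 2 * A.dim →
    (∀ ρ : ℂ, Polynomial.eval₂ (Int.castRingHom ℂ) ρ P = 0 → starRingEnd ℂ ρ ≠ ρ) →
    (∃ Q : Polynomial ℚ, ∀ ρ : ℂ, Polynomial.eval₂ (Int.castRingHom ℂ) ρ P = 0 →
        Polynomial.eval₂ (algebraMap ℚ ℂ) ρ Q = starRingEnd ℂ ρ) →
      ∀ c ∈ weilClassesField A φ P (2 * m), IsRationalClass c →
        IsOfHodgeType A.dim A.X (2 * m) m m c → c ≠ 0 →
        ∃ (𝒳 S : Motives.SchemeOver ℂ) (f : 𝒳 ⟶ S) (s₁ s₀ : Motives.ComplexPoints S)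
            (ι : A.X ≅ Motives.fiberOver f s₁) (W : complexBetti 𝒳 (2 * m)),
          Motives.IsSmoothProjectiveFamily f (e * m) ∧ IsQuasiProjectiveOver 𝒳 ∧ IsQuasiProjectiveOver S ∧
          IrreducibleSpace S.left ∧ AlgebraicGeometry.Smooth S.hom ∧
          (∀ s : Motives.ComplexPoints S,
            IsRationalClass (complexBetti.map (Motives.fiberι f s) (2 * m) W) ∧
              IsOfHodgeType (e * m) (Motives.fiberOver f s) (2 * m) m m
                (complexBetti.map (Motives.fiberι f s) (2 * m) W)) ∧
          (∀ s : Motives.ComplexPoints S, ∃ (A' : Motives.AbelianVariety ℂ) (φ' : A' ⟶ A')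
              (e' : A'.X ≅ Motives.fiberOver f s),
            Polynomial.eval₂ (Int.castRingHom (CategoryTheory.End A')) (φ' : CategoryTheory.End A') P = 0 ∧
              e * (2 * m) = 2 * A'.dim ∧
              complexBetti.map e'.hom (2 * m) (complexBetti.map (Motives.fiberι f s) (2 * m) W) ∈
                weilClassesField A' φ' P (2 * m)) ∧
          complexBetti.map ι.hom (2 * m) (complexBetti.map (Motives.fiberι f s₁) (2 * m) W) = c ∧
          complexBetti.map (Motives.fiberι f s₀) (2 * m) W ∈ algebraicClasses (Motives.fiberOver f s₀) m

end Summit.HodgeConjecture.HodgeConjecture.WeilTypeLadder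

end
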